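import Literature.NumberTheory.LFunctions.EquivalentsHolds
import Literature.NumberTheory.LFunctions.DeBruijnHSimpleZerosProofs
import Literature.NumberTheory.LFunctions.DeBruijnHZeroProofs
import Literature.NumberTheory.LFunctions.RiemannXiLogDeriv
import Literature.NumberTheory.LFunctions.RodgersTaoNotation
import HarnessLib

/-!
# Rodgers–Tao 2020, §2: asymptotics of `H_t` (Lemma 2.1, Remark 2.2, Lemmas 2.3–2.4)

RH-FREE literature typing (cell rh-crit, corpus C3, seat rt-t1; bears_on N-C/N-P). Nothing in this
file bears on the truth of RH: it records, as printed, the saddle-point estimates of §2 of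

* B. Rodgers, T. Tao, *The de Bruijn–Newman constant is non-negative*, Forum Math. Pi 8 (2020) e6
  (= arXiv:1801.05914). **Version pinned:** statements read from the arXiv v4 TeX (§2, Lemma 2.1,
  Remark 2.2, Lemma 2.3, Lemma 2.4) and checked against the published text, FMP pp. 8–19, where
  they are Lemma 4, Remark 5, Lemma 6, Lemma 7; equation numbers (7)–(36) are identical in arXiv
  v4/v5 and FMP and are the ones used below. Lemma 2.3 (ii) is typed from v4/v5/FMP
  (`b ≤ x·exp(100 x^{1/2}/|t|)`, error `log²₊x / x^{3/2}`), NOT from the arXiv v2 wording.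

## What §2 proves and how it is typed here (README §0.4 of the cell = referee finding F1b)

Every statement of §2 is printed for `Λ < t ≤ 0` under the paper's standing assumption `Λ < 0`
(§1.2). The tree proves `0 ≤ Λ` (`deBruijnNewmanConst_nonneg_holds`, via Dobner 2021), so the
printed range is EMPTY; `rodgersTao_lemma21_asPrinted` records Lemma 2.1 literally and is proved
EX FALSO (0 content). The mathematical content of §2 is RH-free and is typed in the generality the
printed proofs give (Remark 2.2: "With a little more effort one could replace the hypothesis
`Λ < t` here by `−C < t`"):

* eq. (7) (upper bound) and Lemma 2.4: for `−T₀ ≤ t ≤ 0` (resp. `< 0`), constants depending on `T₀`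
  — the proofs (FMP pp. 9–10, 15–16) use the `t`-range only through `t ≤ 0` and `|t| = O(1)`;
* eq. (8), (9) (two-sided asymptotic and logarithmic derivative): for `−T₀ ≤ t ≤ 0` and
  `x ≥ C''` — the steepest-descent argument (FMP pp. 11–19) uses no information on zeros; the
  printed extension to all `x ≥ 0` is the compactness remark of p. 11 ("the zeroes of `H_t` for
  `t ≥ Λ` are all real, so that `H_t(z)` is bounded away from zero"), which is where `Λ < t` enters,
  and is NOT claimed here except at `t = 0`, where §2's own `t = 0` paragraph (pp. 9–10) gives
  (13) and the `t = 0` cases of (8), (9) for all `x` unconditionally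
  (`rodgersTao_H0_upper`, `rodgersTao_H0_twoSided`, `rodgersTao_logDeriv_H0_asymp`);
* Lemma 2.3, eq. (22), (31), (18)/(32), (36): `t < 0` with `|t| ≤ T₀`; the printed "absolute"
  constants (which may depend on `Λ`, §1.2) become constants depending on `T₀`.

Divergences from print are repeated in each docstring ("Typed range … / Divergence …").

## Rendering of the asymptotic notation

`X ≪ exp(−πx/8 + O_C(log²₊ x))` ↦ `‖X‖ ≤ exp(−πx/8 + A·log₊(x)²)` for some `A` fixed after `C`
(the outer constant of `≪` is absorbed into `A` because `log₊ x ≥ log 2`); `X = exp(−πx/8 +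
O_C(log²₊ x))` for complex non-zero `X` ↦ the two-sided bound on `‖X‖` (equivalent up to the value
of `A`, the argument being unconstrained); `Y = M + O(E)` ↦ `‖Y − M‖ ≤ A·E`. Points: `z = x − iκ
log₊ x` is `rodgersTaoZ x κ`; `ζ = y + ix ∈ Ω` has `ζ.re = y`, `ζ.im = x`.

## Contents and fact/theorem boundary

Definitions (bodies as printed; `log₊` is the tree's `logPlus` of `RodgersTaoNotation.lean`, the
name of record per rt-lead ruling R1c — not redeclared here): `rodgersTaoZ`, `rodgersTaoI`
(19), `rodgersTaoOmega` (20), `rodgersTaoStrip` (21), `rodgersTaoSaddleEq` (23), `rodgersTaoQ`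
(display after (32)), `rodgersTaoJ` (35), `rodgersTaoK` (display after (35)).
NAMED FACTS (not proved here; RH-FREE): `rodgersTao_H_bound` (7), `rodgersTao_H_asymp` (8),
`rodgersTao_logDeriv_H_asymp` (9), `rodgersTao_H0_upper` (13), `rodgersTao_H0_twoSided` and
`rodgersTao_logDeriv_H0_asymp` (the `t = 0` paragraph, p. 9–10), `rodgersTao_H_hasSum_Q`
((18) = (32)), `rodgersTao_I_shift` (22), `rodgersTao_saddlePoint` (Lemma 2.3 = FMP Lemma 6),
`rodgersTao_I_stationary` (Lemma 2.4 = FMP Lemma 7), `rodgersTao_I_asymp` (31),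
`rodgersTao_Q_one_asymp` (36), `rodgersTao_H_eq_half_Q_one` (last display of §2, p. 19).
THEOREMS: `rodgersTao_lemma21_asPrinted` (ex falso, see above), `rodgersTao_deBruijnH_eq_gaussian`
((15), from the tree's `deBruijnH_sub_sq_eq_integral`), `rodgersTao_logDeriv_H0_eq` (the display
for `H₀'/H₀` on p. 9, from the tree's `logDeriv_riemannXi_eq_of_one_lt_re`), and the API of the
definitions.

CITED, NOT RESTATED (already in the tree): `H_t` = `deBruijnH`, `Λ` = `deBruijnNewmanConst`,
`H_0 = ξ(1/2 + iz/2)/8` = `deBruijnH_zero_eq_holds` (eq. (1)), Gaussian smoothing (15) =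
`deBruijnH_sub_sq_eq_integral`, the classical inputs (10)–(12) (polynomial bound for `ζ`,
Stirling) = `Literature.Analysis.SpecialFunctions.GammaStirling*` /
`Literature.NumberTheory.LFunctions.ZetaConvexityExplicit`, `ξ'/ξ` =
`logDeriv_riemannXi_eq_of_one_lt_re`. Deliberately NOT here: Remark 2.2's unproved extension to
`−C < t` for all `x`; the proof-internal displays (14), (16), (17), (24)–(29), (33), (34).

Printed-constant note (recorded, not repaired): Lemma 2.3 (i) gives `Re(4b e^{4w₀}) ≥ 1`, i.e.
`Re(b e^{4w₀}) ≥ 1/4`, while Lemma 2.4 is printed for `Re b ≥ 1` and (11) is quoted "in the region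
`σ ≥ 1/4`"; the source's footnote to Lemma 2.1 disclaims the numerical constants of §2. Each
statement below is typed with its own printed constant.
-/

noncomputable section

open Complex Set MeasureTheory
open scoped Real

namespace Literature.NumberTheory.LFunctions

/-! ## The points `z = x − iκ log₊ x` (`log₊ = logPlus`, §1.2, `RodgersTaoNotation.lean`) -/

/-- The points `z = x − iκ log₊ x` at which Lemma 2.1 evaluates `H_t` (Rodgers–Tao 2020, Lemma 2.1
= FMP Lemma 4, p. 8). [cite: RodgersTaoFMP2020, Lemma 2.1 (FMP Lemma 4 p. 8)] -/
def rodgersTaoZ (x κ : ℝ) : ℂ :=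
  (x : ℂ) - I * ((κ * logPlus x : ℝ) : ℂ)

/-- The real part of `z = x − iκ log₊ x` is `x` (Lemma 2.1). [cite: RodgersTaoFMP2020, Lemma 2.1 (FMP Lemma 4 p. 8)] -/
@[simp] theorem rodgersTaoZ_re (x κ : ℝ) : (rodgersTaoZ x κ).re = x := by
  simp [rodgersTaoZ]

/-- The imaginary part of `z = x − iκ log₊ x` is `−κ log₊ x` (Lemma 2.1).
[cite: RodgersTaoFMP2020, Lemma 2.1 (FMP Lemma 4 p. 8)] -/
@[simp] theorem rodgersTaoZ_im (x κ : ℝ) : (rodgersTaoZ x κ).im = -(κ * logPlus x) := by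
  simp [rodgersTaoZ]

/-! ## Lemma 2.1 (= FMP Lemma 4): estimates for `H_t(x − iκ log₊ x)` -/

/-- RH-FREE — Rodgers–Tao 2020, Lemma 2.1 = FMP Lemma 4 (p. 8), eq. (7): «Let `z = x − iκ log₊ x`
for some `x ≥ 0` and `0 ≤ κ ≤ C`, and let `Λ < t ≤ 0`. Then `H_t(z) ≪ exp(−πx/8 + O_C(log²₊ x))`.»
Typed range: `−T₀ ≤ t ≤ 0`, the constant `A` depending on `C` and `T₀` (printed: `Λ < t ≤ 0` under
`Λ < 0`, implied constants depending on `C` and on `Λ`; RT Remark 2.2). Divergence: none beyond the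
range — the printed proof (p. 10: (13), (15), triangle inequality) uses only `t ≤ 0` and
`|t| = O(1)`. [cite: RodgersTaoFMP2020, Lemma 2.1 eq. (7) (FMP Lemma 4 p. 8)] -/
def rodgersTao_H_bound : Prop :=
  ∀ C T₀ : ℝ, ∃ A : ℝ, 0 < A ∧ ∀ t ∈ Icc (-T₀) 0, ∀ x : ℝ, 0 ≤ x → ∀ κ ∈ Icc 0 C,
    ‖deBruijnH t (rodgersTaoZ x κ)‖ ≤ Real.exp (-(π * x / 8) + A * logPlus x ^ 2)

/-- RH-FREE — Rodgers–Tao 2020, Lemma 2.1 = FMP Lemma 4 (p. 8), eq. (8): «there is an absolute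
constant `C' > 0` (not depending on `C`) such that if `κ ≥ C'`, then one has the refinement
`H_t(z) = exp(−πx/8 + O_C(log²₊ x))`» (two-sided bound on `|H_t(z)|`, see the module docstring).
Typed range: `−T₀ ≤ t ≤ 0` and `x ≥ C''`, with `C'` depending on `T₀` only and `C''`, `A` on `C`,
`T₀` (printed: `Λ < t ≤ 0`, all `x ≥ 0`). Divergence: the restriction to `x ≥ C''` — the printed
proof reduces to large `x` by compactness using that the zeros of `H_t` are real for `t ≥ Λ`
(FMP p. 11), which is the only use of `Λ < t`; for `x ≥ C''` the saddle-point argument of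
pp. 11–19 is unconditional. The all-`x` statement at `t = 0` is `rodgersTao_H0_twoSided`.
[cite: RodgersTaoFMP2020, Lemma 2.1 eq. (8) (FMP Lemma 4 p. 8)] -/
def rodgersTao_H_asymp : Prop :=
  ∀ T₀ : ℝ, ∃ C' : ℝ, 0 < C' ∧ ∀ C : ℝ, ∃ C'' A : ℝ, 0 < C'' ∧ 0 < A ∧
    ∀ t ∈ Icc (-T₀) 0, ∀ x : ℝ, C'' ≤ x → ∀ κ ∈ Icc C' C,
      Real.exp (-(π * x / 8) - A * logPlus x ^ 2) ≤ ‖deBruijnH t (rodgersTaoZ x κ)‖ ∧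
      ‖deBruijnH t (rodgersTaoZ x κ)‖ ≤ Real.exp (-(π * x / 8) + A * logPlus x ^ 2)

/-- RH-FREE — Rodgers–Tao 2020, Lemma 2.1 = FMP Lemma 4 (p. 8), eq. (9): for `κ ≥ C'`, «the
additional estimate `(H_t'/H_t)(z) = (i/4) log(iz/(4π)) + O_C(log₊ x / x)`, using the standard
branch of the complex logarithm.» Typed range: `−T₀ ≤ t ≤ 0`, `x ≥ C'' > 0`, with `C'` depending
on `T₀` only and `C''`, `A` on `C`, `T₀` (printed: `Λ < t ≤ 0`, all `x ≥ 0`, where the bound is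
infinite at `x = 0`). Divergence: restriction to `x ≥ C''` exactly as for `rodgersTao_H_asymp`
(compactness step of FMP p. 11 uses real zeros for `t ≥ Λ`); the all-`x` statement at `t = 0` is
`rodgersTao_logDeriv_H0_asymp`. `H_t'/H_t` is rendered `deriv (H_t) z / H_t z`.
[cite: RodgersTaoFMP2020, Lemma 2.1 eq. (9) (FMP Lemma 4 p. 8)] -/
def rodgersTao_logDeriv_H_asymp : Prop :=
  ∀ T₀ : ℝ, ∃ C' : ℝ, 0 < C' ∧ ∀ C : ℝ, ∃ C'' A : ℝ, 0 < C'' ∧ 0 < A ∧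
    ∀ t ∈ Icc (-T₀) 0, ∀ x : ℝ, C'' ≤ x → ∀ κ ∈ Icc C' C,
      ‖deriv (deBruijnH t) (rodgersTaoZ x κ) / deBruijnH t (rodgersTaoZ x κ) -
          I / 4 * Complex.log (I * rodgersTaoZ x κ / (4 * π))‖ ≤ A * logPlus x / x

/-- VACUOUS-AS-PRINTED (`Λ ≥ 0`) — Rodgers–Tao 2020, Lemma 2.1 = FMP Lemma 4 (p. 8) with its printed
range `Λ < t ≤ 0` rendered literally over `deBruijnNewmanConst`: (7) for `0 ≤ κ ≤ C`, and for
`C' ≤ κ ≤ C` the lower half of (8) and (9). Since the tree proves `0 ≤ Λ`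
(`deBruijnNewmanConst_nonneg_holds`, Rodgers–Tao Thm. 1.1 via Dobner 2021), the range is empty
and this is proved EX FALSO — 0 content; the content of Lemma 2.1 is in `rodgersTao_H_bound`,
`rodgersTao_H_asymp`, `rodgersTao_logDeriv_H_asymp` and the `t = 0` facts below. Recorded so that
the printed node is never minted as a named fact. [cite: RodgersTaoFMP2020, Lemma 2.1 (FMP Lemma 4 p. 8)] -/
theorem rodgersTao_lemma21_asPrinted :
    ∃ C' : ℝ, 0 < C' ∧ ∀ C : ℝ, ∃ A : ℝ, ∀ t : ℝ, deBruijnNewmanConst < t → t ≤ 0 →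
      ∀ x : ℝ, 0 ≤ x →
        (∀ κ ∈ Icc 0 C,
          ‖deBruijnH t (rodgersTaoZ x κ)‖ ≤ Real.exp (-(π * x / 8) + A * logPlus x ^ 2)) ∧
        (∀ κ ∈ Icc C' C,
          Real.exp (-(π * x / 8) - A * logPlus x ^ 2) ≤ ‖deBruijnH t (rodgersTaoZ x κ)‖ ∧
          (0 < x → ‖deriv (deBruijnH t) (rodgersTaoZ x κ) / deBruijnH t (rodgersTaoZ x κ) -
              I / 4 * Complex.log (I * rodgersTaoZ x κ / (4 * π))‖ ≤ A * logPlus x / x)) :=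
  ⟨1, one_pos, fun _ ↦ ⟨0, fun _ ht ht0 ↦
    absurd (ht.trans_le ht0) (not_lt.2 (deBruijnNewmanConst_nonneg_holds : 0 ≤ deBruijnNewmanConst))⟩⟩

/-! ## The case `t = 0` (FMP pp. 9–10): unconditional, all `x` -/

/-- RH-FREE — Rodgers–Tao 2020, §2 eq. (13) (FMP p. 9): «the crude upper bound
`H_0(x − iy) ≪ exp(−π|x|/8 + O((1 + y) log₊(|x| + y)))` for `x ∈ ℝ` and `y ≥ 0`» (from the
polynomial bound (10) for `ζ` on `σ ≥ 1/2` and Stirling (11)–(12), inserted in (1), (2)). Typed as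
printed (one constant `A`, outer `≪`-constant absorbed). Divergence: none.
[cite: RodgersTaoFMP2020, §2 eq. (13) (FMP p. 9)] -/
def rodgersTao_H0_upper : Prop :=
  ∃ A : ℝ, 0 < A ∧ ∀ x y : ℝ, 0 ≤ y →
    ‖deBruijnH 0 ((x : ℂ) - I * y)‖ ≤
      Real.exp (-(π * |x| / 8) + A * (1 + y) * logPlus (|x| + y))

/-- RH-FREE — Rodgers–Tao 2020, §2, display after (13) (FMP p. 9): «when `σ ≥ 2` (say) we can
improve (10) to `|ζ(σ + iτ)| ≍ 1` and so we obtain the improvement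
`H_0(x − iy) = exp(−π|x|/8 + O((1 + y) log₊(|x| + y)))` when `y ≥ C' log₊ x` (in fact in this case
it would suffice to have `y ≥ 4`, say)» — the `t = 0` case of (8), for all `x`. Typed with the
printed sufficient condition `y ≥ 4` (then `σ = (1 + y)/2 ≥ 5/2`) as a two-sided bound on
`|H_0(x − iy)|`. Divergence: none. [cite: RodgersTaoFMP2020, §2 display after eq. (13) (FMP p. 9)] -/
def rodgersTao_H0_twoSided : Prop :=
  ∃ A : ℝ, 0 < A ∧ ∀ x y : ℝ, 4 ≤ y →
    Real.exp (-(π * |x| / 8) - A * (1 + y) * logPlus (|x| + y)) ≤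
        ‖deBruijnH 0 ((x : ℂ) - I * y)‖ ∧
      ‖deBruijnH 0 ((x : ℂ) - I * y)‖ ≤
        Real.exp (-(π * |x| / 8) + A * (1 + y) * logPlus (|x| + y))

/-- RH-FREE — Rodgers–Tao 2020, §2, the `t = 0` case of eq. (9) (FMP pp. 9–10): from the identity
`rodgersTao_logDeriv_H0_eq`, `(Γ'/Γ)(s/2) = log(s/2) + O(1/|s|)` and `(ζ'/ζ)(s) ≪ 1/|s|` «in the
regime `C' log₊ x ≤ y ≤ C log x`. Putting all this together, one obtains (9) in this case.» — i.e.
there is an absolute `C' > 0` such that for every `C` and all `x > 0`, `C' ≤ κ ≤ C`,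
`(H_0'/H_0)(z) = (i/4) log(iz/(4π)) + O_C(log₊ x / x)` at `z = x − iκ log₊ x`. Typed for all
`x > 0` (printed `x ≥ 0`; the bound is infinite at `x = 0`). Divergence: none.
[cite: RodgersTaoFMP2020, Lemma 2.1 eq. (9) case t = 0 (FMP pp. 9–10)] -/
def rodgersTao_logDeriv_H0_asymp : Prop :=
  ∃ C' : ℝ, 0 < C' ∧ ∀ C : ℝ, ∃ A : ℝ, 0 < A ∧ ∀ x : ℝ, 0 < x → ∀ κ ∈ Icc C' C,
    ‖deriv (deBruijnH 0) (rodgersTaoZ x κ) / deBruijnH 0 (rodgersTaoZ x κ) -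
        I / 4 * Complex.log (I * rodgersTaoZ x κ / (4 * π))‖ ≤ A * logPlus x / x

/-- RH-FREE — Rodgers–Tao 2020, §2, display after (13) (FMP p. 9): «from taking logarithmic
derivatives of (1), (2) one has `(H_0'/H_0)(z) = (i/2)(1/s + 1/(s − 1) − ½ log π + ½ (Γ'/Γ)(s/2)
+ (ζ'/ζ)(s))` where `s := 1/2 + iz/2`.» PROVED from the tree's `H_0 = ξ(1/2 + iz/2)/8`
(`deBruijnH_zero_eq_holds`) and `ξ'/ξ` (`logDeriv_riemannXi_eq_of_one_lt_re`). Typed on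
`Re s > 1`, where every term is finite and `ξ(s) ≠ 0` (the source uses it for `Re s ≥ 2`).
[cite: RodgersTaoFMP2020, §2 display after eq. (13) (FMP p. 9)] -/
theorem rodgersTao_logDeriv_H0_eq {z : ℂ} (hs : 1 < (1 / 2 + I * z / 2).re) :
    deriv (deBruijnH 0) z / deBruijnH 0 z =
      I / 2 * (1 / (1 / 2 + I * z / 2) + 1 / (1 / 2 + I * z / 2 - 1) - Real.log π / 2 +
        Complex.digamma ((1 / 2 + I * z / 2) / 2) / 2 +
        deriv riemannZeta (1 / 2 + I * z / 2) / riemannZeta (1 / 2 + I * z / 2)) := by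
  set s : ℂ := 1 / 2 + I * z / 2 with hs_def
  have hH : deBruijnH 0 = fun w ↦ riemannXi (1 / 2 + I * w / 2) / 8 :=
    funext deBruijnH_zero_eq_holds
  have hg : HasDerivAt (fun w : ℂ ↦ 1 / 2 + I * w / 2) (I / 2) z := by
    simpa using (((hasDerivAt_id z).const_mul I).div_const 2).const_add (1 / 2 : ℂ)
  have hξ : HasDerivAt riemannXi (deriv riemannXi s) s :=
    (differentiable_riemannXi s).hasDerivAt
  have hcomp : HasDerivAt (fun w ↦ riemannXi (1 / 2 + I * w / 2) / 8)
      (deriv riemannXi s * (I / 2) / 8) z := by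
    have h8 := (hξ.comp z hg).div_const 8
    simpa only [Function.comp_def] using h8
  have hder : deriv (deBruijnH 0) z = deriv riemannXi s * (I / 2) / 8 := by
    rw [hH]; exact hcomp.deriv
  have hval : deBruijnH 0 z = riemannXi s / 8 := deBruijnH_zero_eq_holds z
  have hξ0 : riemannXi s ≠ 0 := riemannXi_ne_zero_of_one_le_re hs.le
  have hlog := logDeriv_riemannXi_eq_of_one_lt_re hs
  rw [logDeriv_apply, ArithmeticFunction.LSeries_vonMangoldt_eq_deriv_riemannZeta_div hs] at hlog
  rw [hder, hval]
  have : deriv riemannXi s * (I / 2) / 8 / (riemannXi s / 8) = I / 2 * (deriv riemannXi s / riemannXi s) := by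
    field_simp
  rw [this, hlog]
  ring

/-! ## The case `t < 0`: Gaussian smoothing (15) and the series (18) -/

/-- RH-FREE — Rodgers–Tao 2020, §2 eq. (15) (FMP p. 10): for `t < 0` (here `t ≤ 0`),
`H_t(z) = (4π)^{-1/2} ∫_ℝ e^{−r²/4} H_0(z + r|t|^{1/2}) dr`. PROVED: this is the tree's Gaussian
smoothing identity `deBruijnH_sub_sq_eq_integral` at `t₀ = 0`, `σ = |t|^{1/2} = √|t|`.
[cite: RodgersTaoFMP2020, §2 eq. (15) (FMP p. 10)] -/
theorem rodgersTao_deBruijnH_eq_gaussian {t : ℝ} (ht : t ≤ 0) (z : ℂ) :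
    deBruijnH t z = (((4 * Real.pi : ℝ) : ℂ) ^ (1 / 2 : ℂ))⁻¹ *
      ∫ r : ℝ, Complex.exp (-(r : ℂ) ^ 2 / 4) * deBruijnH 0 (z + Real.sqrt |t| * r) := by
  have h := deBruijnH_sub_sq_eq_integral 0 (Real.sqrt |t|) z
  have h0 : (0 : ℝ) - Real.sqrt |t| ^ 2 = t := by
    rw [Real.sq_sqrt (abs_nonneg t), abs_of_nonpos ht]; ring
  rwa [h0] at h

/-- The oscillatory integral `I_t(b, ζ) := ∫_ℝ exp(tw² − b e^{4w} + ζw) dw` of Rodgers–Tao 2020,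
§2 eq. (19) (FMP p. 11), «an absolutely convergent integral for `t < 0` whenever `Re b > 0`»
(Bochner integral; junk outside that regime). [cite: RodgersTaoFMP2020, §2 eq. (19) (FMP p. 11)] -/
def rodgersTaoI (t : ℝ) (b ζ : ℂ) : ℂ :=
  ∫ w : ℝ, Complex.exp (t * (w : ℂ) ^ 2 - b * Complex.exp (4 * w) + ζ * w)

/-- `Q_{t,n} := 2π² n⁴ I_t(πn², 9 + y + ix) − 3π n² I_t(πn², 5 + y + ix)` (Rodgers–Tao 2020, §2,
display after (32), FMP p. 17; the summand of (18)), for `z = x − iy`.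
[cite: RodgersTaoFMP2020, §2 display after eq. (32) (FMP p. 17)] -/
def rodgersTaoQ (t : ℝ) (n : ℕ) (x y : ℝ) : ℂ :=
  2 * π ^ 2 * (n : ℂ) ^ 4 * rodgersTaoI t (π * (n : ℂ) ^ 2) (9 + y + x * I) -
    3 * π * (n : ℂ) ^ 2 * rodgersTaoI t (π * (n : ℂ) ^ 2) (5 + y + x * I)

/-- RH-FREE — Rodgers–Tao 2020, §2 eq. (18) (FMP p. 11) = eq. (32) (p. 17): for `t < 0` and
`z = x − iy`, «from (3) and Fubini's theorem (which can be justified when `t < 0`) we conclude that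
`H_t(z) = ½ ∑_{n=1}^∞ 2π²n⁴ I_t(πn², 9 + y + ix) − 3πn² I_t(πn², 5 + y + ix)`», i.e.
`H_t(x − iy) = ½ ∑_{n ≥ 1} Q_{t,n}`. Typed as `HasSum` (the printed derivation gives absolute
convergence) for all real `x`, `y` (the source writes it at the points of Lemma 2.1; the derivation
is for arbitrary `z`). Divergence: none. [cite: RodgersTaoFMP2020, §2 eq. (18) and (32) (FMP pp. 11 and 17)] -/
def rodgersTao_H_hasSum_Q : Prop :=
  ∀ t : ℝ, t < 0 → ∀ x y : ℝ,
    HasSum (fun n : ℕ ↦ rodgersTaoQ t (n + 1) x y) (2 * deBruijnH t ((x : ℂ) - I * y))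

/-! ## The saddle point: (20)–(23), Lemma 2.3 (= FMP Lemma 6), Lemma 2.4 (= FMP Lemma 7) -/

/-- The region `Ω := {y + ix : x ≥ C''; C' log₊ x ≤ y ≤ 2C log₊ x}` of Rodgers–Tao 2020, §2
eq. (20) (FMP p. 11), as a subset of `ℂ` (`ζ.re = y`, `ζ.im = x`); `C'` large absolute, `C''` large
depending on `C` in the source. [cite: RodgersTaoFMP2020, §2 eq. (20) (FMP p. 11)] -/
def rodgersTaoOmega (C C' C'' : ℝ) : Set ℂ :=
  {ζ : ℂ | C'' ≤ ζ.im ∧ C' * logPlus ζ.im ≤ ζ.re ∧ ζ.re ≤ 2 * C * logPlus ζ.im}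

/-- Membership in `Ω` (eq. (20)), unfolded. [cite: RodgersTaoFMP2020, §2 eq. (20) (FMP p. 11)] -/
theorem mem_rodgersTaoOmega {C C' C'' : ℝ} {ζ : ℂ} :
    ζ ∈ rodgersTaoOmega C C' C'' ↔
      C'' ≤ ζ.im ∧ C' * logPlus ζ.im ≤ ζ.re ∧ ζ.re ≤ 2 * C * logPlus ζ.im :=
  Iff.rfl

/-- The strip `{w₀ ∈ ℂ : 0 ≤ Im w₀ < π/8}` of Rodgers–Tao 2020, §2 eq. (21) (FMP p. 12).
[cite: RodgersTaoFMP2020, §2 eq. (21) (FMP p. 12)] -/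
def rodgersTaoStrip : Set ℂ :=
  {w : ℂ | 0 ≤ w.im ∧ w.im < π / 8}

/-- Membership in the strip (21), unfolded. [cite: RodgersTaoFMP2020, §2 eq. (21) (FMP p. 12)] -/
theorem mem_rodgersTaoStrip {w : ℂ} : w ∈ rodgersTaoStrip ↔ 0 ≤ w.im ∧ w.im < π / 8 := Iff.rfl

/-- The saddle-point equation `4b e^{4w₀} = ζ + 2t w₀` of Rodgers–Tao 2020, §2 eq. (23) (FMP
p. 12). [cite: RodgersTaoFMP2020, §2 eq. (23) (FMP p. 12)] -/
def rodgersTaoSaddleEq (t : ℝ) (b ζ w₀ : ℂ) : Prop :=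
  4 * b * Complex.exp (4 * w₀) = ζ + 2 * t * w₀

/-- RH-FREE — Rodgers–Tao 2020, §2 eq. (22) (FMP p. 12): for `w₀` in the strip (21), «we see from
shifting the contour in (19) to the horizontal line `{w + w₀ : w ∈ ℝ}` that we have the identity
`I_t(b, ζ) = exp(tw₀² + ζw₀) I_t(b e^{4w₀}, ζ + 2tw₀)` whenever `b > 0` (so that `b e^{4w₀}` has
positive real part)». Typed for `t < 0` (the standing case of this part of §2), real `b > 0`, all
`ζ`. Divergence: none. [cite: RodgersTaoFMP2020, §2 eq. (22) (FMP p. 12)] -/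
def rodgersTao_I_shift : Prop :=
  ∀ t : ℝ, t < 0 → ∀ b : ℝ, 0 < b → ∀ ζ : ℂ, ∀ w₀ ∈ rodgersTaoStrip,
    rodgersTaoI t b ζ =
      Complex.exp (t * w₀ ^ 2 + ζ * w₀) * rodgersTaoI t (b * Complex.exp (4 * w₀)) (ζ + 2 * t * w₀)

/-- RH-FREE — Rodgers–Tao 2020, Lemma 2.3 = FMP Lemma 6 (p. 12): «If `b ≥ 1` and `ζ ∈ Ω`, then
there exists a unique `w₀ = w₀(b, ζ)` in the strip (21) such that (23) holds. Furthermore: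
(i) `Re(4b e^{4w₀}) ≥ 1`. (ii) (Precise asymptotic for small and medium `b`) If `ζ = y + ix` and
`b ≤ x exp(100 x^{1/2}/|t|)`, then `w₀ = ¼ log(x/4b) + O^ℝ(1/x) + i(π/8 − y/(4x) −
t log(x/4b)/(8x) + O^ℝ_C(log²₊ x / x^{3/2}))`, the superscript indicating real-valued errors.
(iii) (Crude bound for huge `b`) If `ζ = y + ix` and `b > x exp(x^{1/2}/|t|)`, then `Re w₀` is
negative; in fact `−Re w₀ ≥ ⅛ log₊ b`.» (Clause (ii) as in arXiv v4/v5/FMP.) Typed range: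
`−T₀ ≤ t < 0`; `C' ≥ C'₀(T₀)`, `C'' ≥ C''₀(C, C', T₀)` ("`C, C'` large", "`x ≥ C''` large depending
on `C`" in the source); `A₁` (the `O^ℝ(1/x)`) depends on `T₀` only, `A₂` (the `O^ℝ_C`) on
`C, C', T₀` (printed: absolute resp. `C`-dependent, `|t| ≤ |Λ|`). Divergence: none otherwise.
[cite: RodgersTaoFMP2020, Lemma 2.3 (FMP Lemma 6 p. 12)] -/
def rodgersTao_saddlePoint : Prop :=
  ∀ T₀ : ℝ, ∃ C'₀ A₁ : ℝ, 0 < C'₀ ∧ 0 < A₁ ∧ ∀ C' : ℝ, C'₀ ≤ C' → ∀ C : ℝ,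
    ∃ C''₀ A₂ : ℝ, 0 < C''₀ ∧ 0 < A₂ ∧ ∀ C'' : ℝ, C''₀ ≤ C'' →
    ∀ t ∈ Ico (-T₀) 0, ∀ b : ℝ, 1 ≤ b → ∀ ζ ∈ rodgersTaoOmega C C' C'',
      (∃! w₀ : ℂ, w₀ ∈ rodgersTaoStrip ∧ rodgersTaoSaddleEq t b ζ w₀) ∧
      ∀ w₀ ∈ rodgersTaoStrip, rodgersTaoSaddleEq t b ζ w₀ →
        1 ≤ (4 * (b : ℂ) * Complex.exp (4 * w₀)).re ∧
        (b ≤ ζ.im * Real.exp (100 * Real.sqrt ζ.im / |t|) →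
          |w₀.re - Real.log (ζ.im / (4 * b)) / 4| ≤ A₁ / ζ.im ∧
          |w₀.im - (π / 8 - ζ.re / (4 * ζ.im) - t * Real.log (ζ.im / (4 * b)) / (8 * ζ.im))| ≤
            A₂ * logPlus ζ.im ^ 2 / ζ.im ^ (3 / 2 : ℝ)) ∧
        (ζ.im * Real.exp (Real.sqrt ζ.im / |t|) < b → logPlus b / 8 ≤ -w₀.re)

/-- RH-FREE — Rodgers–Tao 2020, Lemma 2.4 = FMP Lemma 7 (p. 15), eq. (30): «Let `b` be a complex
number with `Re b ≥ 1`. Then `I_t(b, 4b) = √(π/8) exp(−b) (1/√b + O(1/|b|^{3/2}))` using the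
standard branch of the square root.» (`t < 0` from the context "Henceforth we address the `t < 0`
case", p. 10.) Typed range: `−T₀ ≤ t < 0`, `A` depending on `T₀` (printed: implied constant
absolute, `|t| ≤ |Λ|`; the proof, pp. 15–16, uses `|t| = O(1)` through the variance `|t|/8` of the
Gaussian measure). `1/√b` is `b^{-1/2}` (principal branch). Divergence: none otherwise.
[cite: RodgersTaoFMP2020, Lemma 2.4 eq. (30) (FMP Lemma 7 p. 15)] -/
def rodgersTao_I_stationary : Prop :=
  ∀ T₀ : ℝ, ∃ A : ℝ, 0 < A ∧ ∀ t ∈ Ico (-T₀) 0, ∀ b : ℂ, 1 ≤ b.re →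
    ‖rodgersTaoI t b (4 * b) -
        (Real.sqrt (π / 8) : ℂ) * Complex.exp (-b) * b ^ (-(1 / 2 : ℂ))‖ ≤
      A * ‖Complex.exp (-b)‖ / ‖b‖ ^ (3 / 2 : ℝ)

/-- RH-FREE — Rodgers–Tao 2020, §2 eq. (31) (FMP p. 16): «From the above two lemmas and (22), we have
the asymptotic `I_t(b, ζ) = √(π/8) exp(tw₀² − b e^{4w₀} + ζw₀) (1/√(b e^{4w₀}) +
O(1/|b e^{4w₀}|^{3/2}))` for any `b ≥ 1` and `ζ ∈ Ω`, where `w₀ = w₀(b, ζ)` is the quantity in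
Lemma 2.3.» Typed range and thresholds as in `rodgersTao_saddlePoint`; stated for every `w₀` in the
strip solving (23) (unique by Lemma 2.3). Kept as its own fact: with the printed constants it does
not follow formally from Lemmas 2.3–2.4 (Lemma 2.3 (i) gives `Re(b e^{4w₀}) ≥ 1/4`, Lemma 2.4 asks
`Re ≥ 1`; see the module docstring). [cite: RodgersTaoFMP2020, §2 eq. (31) (FMP p. 16)] -/
def rodgersTao_I_asymp : Prop :=
  ∀ T₀ : ℝ, ∃ C'₀ : ℝ, 0 < C'₀ ∧ ∀ C' : ℝ, C'₀ ≤ C' → ∀ C : ℝ, ∃ C''₀ A : ℝ, 0 < C''₀ ∧ 0 < A ∧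
    ∀ C'' : ℝ, C''₀ ≤ C'' → ∀ t ∈ Ico (-T₀) 0, ∀ b : ℝ, 1 ≤ b → ∀ ζ ∈ rodgersTaoOmega C C' C'',
      ∀ w₀ ∈ rodgersTaoStrip, rodgersTaoSaddleEq t b ζ w₀ →
        ‖rodgersTaoI t b ζ -
            (Real.sqrt (π / 8) : ℂ) * Complex.exp (t * w₀ ^ 2 - b * Complex.exp (4 * w₀) + ζ * w₀) *
              ((b : ℂ) * Complex.exp (4 * w₀)) ^ (-(1 / 2 : ℂ))‖ ≤
          A * ‖Complex.exp (t * w₀ ^ 2 - b * Complex.exp (4 * w₀) + ζ * w₀)‖ /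
            ‖(b : ℂ) * Complex.exp (4 * w₀)‖ ^ (3 / 2 : ℝ)

/-! ## The main term `Q_{t,1}` (FMP pp. 17–19) -/

/-- `J_t(x) := √(π/(2x)) exp((t/16) log²(x/4π) − tπ²/64 − πx/8)` (Rodgers–Tao 2020, §2 eq. (35),
FMP p. 18). [cite: RodgersTaoFMP2020, §2 eq. (35) (FMP p. 18)] -/
def rodgersTaoJ (t x : ℝ) : ℝ :=
  Real.sqrt (π / (2 * x)) *
    Real.exp (t / 16 * Real.log (x / (4 * π)) ^ 2 - t * π ^ 2 / 64 - π * x / 8)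

/-- `K_{t,n}(x) := exp(−(t/4) log(x/4π) log n + (t/4) log² n)` (Rodgers–Tao 2020, §2, display after
(35), FMP p. 18). [cite: RodgersTaoFMP2020, §2 display after eq. (35) (FMP p. 18)] -/
def rodgersTaoK (t : ℝ) (n : ℕ) (x : ℝ) : ℝ :=
  Real.exp (-(t / 4) * Real.log (x / (4 * π)) * Real.log n + t / 4 * Real.log n ^ 2)

/-- `J_t(x) > 0` for `x > 0` ("the positive quantities `J_t`, `K_{t,n}`", FMP p. 18).
[cite: RodgersTaoFMP2020, §2 eq. (35) (FMP p. 18)] -/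
theorem rodgersTaoJ_pos (t : ℝ) {x : ℝ} (hx : 0 < x) : 0 < rodgersTaoJ t x :=
  mul_pos (Real.sqrt_pos.2 (by positivity)) (Real.exp_pos _)

/-- `K_{t,n}(x) > 0` ("the positive quantities `J_t`, `K_{t,n}`", FMP p. 18).
[cite: RodgersTaoFMP2020, §2 display after eq. (35) (FMP p. 18)] -/
theorem rodgersTaoK_pos (t : ℝ) (n : ℕ) (x : ℝ) : 0 < rodgersTaoK t n x := Real.exp_pos _

/-- RH-FREE — Rodgers–Tao 2020, §2 eq. (36) (FMP p. 18): at `z = x − iy`, `y = κ log₊ x`,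
`C' ≤ κ ≤ C`, `x ≥ C''`, «for `n = 1` we have the refinement
`|Q_{t,1}| = (2π² + O_C(x^{-1/2})) (x/4π)^{(9+y)/4} J_t`». Typed range: `−T₀ ≤ t < 0`, thresholds
`C'`, `C''` and the constant as in `rodgersTao_saddlePoint` (printed: `Λ < t < 0`). Divergence:
none otherwise. [cite: RodgersTaoFMP2020, §2 eq. (36) (FMP p. 18)] -/
def rodgersTao_Q_one_asymp : Prop :=
  ∀ T₀ : ℝ, ∃ C' : ℝ, 0 < C' ∧ ∀ C : ℝ, ∃ C'' A : ℝ, 0 < C'' ∧ 0 < A ∧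
    ∀ t ∈ Ico (-T₀) 0, ∀ x : ℝ, C'' ≤ x → ∀ κ ∈ Icc C' C,
      |‖rodgersTaoQ t 1 x (κ * logPlus x)‖ /
            ((x / (4 * π)) ^ ((9 + κ * logPlus x) / 4) * rodgersTaoJ t x) - 2 * π ^ 2| ≤
        A / Real.sqrt x

/-- RH-FREE — Rodgers–Tao 2020, §2, last display of the proof of Lemma 2.1 (FMP p. 19): at
`z = x − iy`, `y = κ log₊ x`, `C' ≤ κ ≤ C`, `x ≥ C''`, «Inserting these bounds into (18), we
conclude that `H_t(x − iy) = (½ + O_C(log²₊ x / x)) Q_{t,1}`» (the precise form of (8) for `t < 0`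
alluded to in Remark 2.2). Typed range: `−T₀ ≤ t < 0` with thresholds as in
`rodgersTao_saddlePoint` (printed `Λ < t < 0`). Divergence: none otherwise.
[cite: RodgersTaoFMP2020, §2 proof of Lemma 2.1 last display (FMP p. 19)] -/
def rodgersTao_H_eq_half_Q_one : Prop :=
  ∀ T₀ : ℝ, ∃ C' : ℝ, 0 < C' ∧ ∀ C : ℝ, ∃ C'' A : ℝ, 0 < C'' ∧ 0 < A ∧
    ∀ t ∈ Ico (-T₀) 0, ∀ x : ℝ, C'' ≤ x → ∀ κ ∈ Icc C' C,
      ‖deBruijnH t (rodgersTaoZ x κ) - rodgersTaoQ t 1 x (κ * logPlus x) / 2‖ ≤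
        A * (logPlus x ^ 2 / x) * ‖rodgersTaoQ t 1 x (κ * logPlus x)‖

end Literature.NumberTheory.LFunctions
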